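import Summits.MatrixMultiplication.MatrixMultiplication.Theorems.ObstructionDescentUniversalOccurrenceTwoRectangleHookTableaux

set_option linter.dupNamespace false
set_option autoImplicit false

/-!
# Universal occurrence — two rectangles, THREE-ROW TYPES `(2N-2k-4, 2k+2, 2)`, part P: the tall-pair tableau (decomp-mm · lens 3 · gen 43)

Route `route-MatrixMultiplication-ObstructionDescent` (sub-problem `MatrixMultiplication`, `ω(ℂ) = 2`); SUPPORT for the crux
`NoOccurrenceObstruction` (`P_O`, item `stmt-MatrixMultiplication-29040`) through the universal-occurrence programme (NODE-g29…g43
of the decomp-mm cell, lens 3).  Nothing here proves `ω = 2` or closes an item; no `def`, no `sorry`, standard axioms.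

**Why.**  After the generic two-row family (`occurs_unitTensor_twoRectangle_twoRows`, parts L–O) the next two-parameter family of
the programme is `ν = (2N-2k-4, 2k+2, 2)` (`k ≥ 0` column pairs of height `2` behind ONE pair of columns of height `3`; `k = 0` is
the hook `(2N-4,2,2)`, `k = 1` is `(2N-6,4,2)` of parts A–C).  This file is the shape-specific foundation, generic in `k`.

**The tall-pair tableau `T`.**  Positions `p < 6` ↦ cell `(p mod 3, ⌊p/3⌋)` (columns `0,1` of height `3`); `6 ≤ p < 4k+6` ↦
`(p mod 2, ⌊p/2⌋ - 1)` (the `k` pairs: pair `j` on positions `4j+6 … 4j+9`, first column `(p+2) mod 4 < 2`); `p ≥ 4k+6` ↦ arm cell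
`(0, p-2k-4)`.  §1: cells (`tallPairCell_*`, `mem_youngDiagram_threeRows`).  §2: support of `e_T` (arm letters `0`, letters `< 3` on
the tall pair, `< 2` on the pairs, columns injective: `tallPairTableau_support`) and the twin lemma (`u(p+3) = u(p)` for `p < 3`,
`u(p+2) = u(p)` on the first pair columns ⟹ `e_T(u) = 1`: `tallPairTableau_twin_eq_one`, `ρ = ρ₀ · κρ₀κ`).

[cite: BurgisserIkenmeyer2011, §3.4 (Prop. 3.4), Thm. 4.4] [cite: BurgisserIkenmeyer2017, §5, Thm. 5.9 (proof of (2)), eq. (3.4)]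
[cite: Landsberg2017, §9.1.1]
-/

noncomputable section

open scoped BigOperators

namespace Summit.MatrixMultiplication.MatrixMultiplication.Theorems.ObstructionCalculus

open Literature.Computability.AlgebraicComplexity
open Literature.NumberTheory.DiophantineGeometry

/-! ### §1 The tall-pair tableau of `(2N-2k-4, 2k+2, 2)` -/

/-- Cells of the tall-pair tableau are distinct. [folklore] -/
theorem tallPairCell_injective {k p q : ℕ}
    (hpq : (if p < 6 then (p % 3, p / 3) else if p < 4 * k + 6 then (p % 2, p / 2 - 1) else (0, p - 2 * k - 4) : ℕ × ℕ) =
      (if q < 6 then (q % 3, q / 3) else if q < 4 * k + 6 then (q % 2, q / 2 - 1) else (0, q - 2 * k - 4))) : p = q := by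
  split_ifs at hpq <;> simp only [Prod.mk.injEq] at hpq <;> omega

/-- The tall-pair tableau is a standard filling for the position order. [folklore] -/
theorem tallPairCell_standard {k p q : ℕ} (hpq : p < q) :
    ¬ ((if q < 6 then (q % 3, q / 3) else if q < 4 * k + 6 then (q % 2, q / 2 - 1) else (0, q - 2 * k - 4) : ℕ × ℕ) ≤
      (if p < 6 then (p % 3, p / 3) else if p < 4 * k + 6 then (p % 2, p / 2 - 1) else (0, p - 2 * k - 4))) := by
  split_ifs <;> simp only [Prod.mk_le_mk] <;> omega

/-- The Young diagram of `(2N-2k-4, 2k+2, 2)` (`2k+3 ≤ N`): its boxes. [folklore] -/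
theorem mem_youngDiagram_threeRows {N k : ℕ} (ν : Nat.Partition (N * 2))
    (hν : ν.sortedParts = [2 * N - 2 * k - 4, 2 * k + 2, 2]) {r c : ℕ}
    (h : (r = 0 ∧ c < 2 * N - 2 * k - 4) ∨ (r = 1 ∧ c < 2 * k + 2) ∨ (r = 2 ∧ c < 2)) :
    (r, c) ∈ ν.youngDiagram := by
  rw [Nat.Partition.mem_youngDiagram_iff, hν]
  rcases h with ⟨rfl, hc⟩ | ⟨rfl, hc⟩ | ⟨rfl, hc⟩
  · exact ⟨by simp, by simpa using hc⟩
  · exact ⟨by simp, by simpa using hc⟩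
  · exact ⟨by simp, by simpa using hc⟩

/-- `(2N-2k-4, 2k+2, 2)` has three rows. [folklore] -/
theorem fst_lt_of_mem_youngDiagram_threeRows {N k : ℕ} (ν : Nat.Partition (N * 2))
    (hν : ν.sortedParts = [2 * N - 2 * k - 4, 2 * k + 2, 2]) {x : ℕ × ℕ}
    (hx : x ∈ ν.youngDiagram.cells) : x.1 < 3 := by
  obtain ⟨h, -⟩ := (Nat.Partition.mem_youngDiagram_iff ν x).1 ((YoungDiagram.mem_cells _).1 hx)
  rw [hν] at h
  simpa using h

/-- The cells of the tall-pair tableau lie in `(2N-2k-4, 2k+2, 2)` (`2k+3 ≤ N`). [folklore] -/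
theorem tallPairCell_mem_threeRows {N k : ℕ} (hN : 2 * k + 3 ≤ N) (ν : Nat.Partition (N * 2))
    (hν : ν.sortedParts = [2 * N - 2 * k - 4, 2 * k + 2, 2]) (p : ℕ) (hp : p < N * 2) :
    (if p < 6 then (p % 3, p / 3) else if p < 4 * k + 6 then (p % 2, p / 2 - 1) else (0, p - 2 * k - 4) : ℕ × ℕ) ∈
      ν.youngDiagram := by
  split_ifs with h1 h2 <;> apply mem_youngDiagram_threeRows ν hν
  · have h3 : p % 3 = 0 ∨ p % 3 = 1 ∨ p % 3 = 2 := by omega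
    rcases h3 with h | h | h
    · left; rw [h]; constructor <;> omega
    · right; left; rw [h]; constructor <;> omega
    · right; right; rw [h]; constructor <;> omega
  · rcases Nat.mod_two_eq_zero_or_one p with h | h
    · left; rw [h]; constructor <;> omega
    · right; left; rw [h]; constructor <;> omega
  · left; constructor <;> omega

/-! ### §2 Support and twins -/

/-- **Support of `e_T`.**  If `e_T(u) ≠ 0` then `u` vanishes on the arm, has letters `< 3` on the tall pair and `< 2` on the pairs,
and is injective on every column. [folklore] -/
theorem tallPairTableau_support {N k : ℕ} {Y : YoungDiagram} (hN : ∀ x ∈ Y.cells, x.1 < N)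
    (T : StdFilling (N * 2) Y)
    (hT : ∀ p : Fin (N * 2), T.1 p = (if (p : ℕ) < 6 then ((p : ℕ) % 3, (p : ℕ) / 3)
      else if (p : ℕ) < 4 * k + 6 then ((p : ℕ) % 2, (p : ℕ) / 2 - 1) else (0, (p : ℕ) - 2 * k - 4)))
    {u : Word N (N * 2)} (hu : T.polytabloid ℂ hN u ≠ 0) :
    (∀ p : Fin (N * 2), 4 * k + 6 ≤ (p : ℕ) → ((u p : Fin N) : ℕ) = 0) ∧
    (∀ p : Fin (N * 2), ((u p : Fin N) : ℕ) < 3) ∧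
    (∀ p : Fin (N * 2), 6 ≤ (p : ℕ) → ((u p : Fin N) : ℕ) < 2) ∧
    (∀ p q : Fin (N * 2), (T.1 p).2 = (T.1 q).2 → u p = u q → p = q) := by
  classical
  obtain ⟨σ, hσ, rfl⟩ := StdFilling.exists_of_polytabloid_apply_ne_zero hN T hu
  have hcol : ∀ p, (T.1 (σ p)).2 = (T.1 p).2 := StdFilling.mem_colStab.1 hσ
  have hval : ∀ p, ((StdFilling.rowWord hN T ∘ ⇑σ) p : ℕ) = (T.1 (σ p)).1 := fun p => rfl
  have hrow' : ∀ q : Fin (N * 2), (T.1 q).1 =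
      if (q : ℕ) < 6 then (q : ℕ) % 3 else if (q : ℕ) < 4 * k + 6 then (q : ℕ) % 2 else 0 := fun q => by
    rw [hT]; split_ifs <;> rfl
  have hcol' : ∀ q : Fin (N * 2), (T.1 q).2 =
      if (q : ℕ) < 6 then (q : ℕ) / 3 else if (q : ℕ) < 4 * k + 6 then (q : ℕ) / 2 - 1 else (q : ℕ) - 2 * k - 4 :=
    fun q => by rw [hT]; split_ifs <;> rfl
  refine ⟨fun p hp => ?_, fun p => ?_, fun p hp => ?_, fun p q hpq hupq => ?_⟩
  · have hc := hcol p
    rw [hcol', hcol'] at hc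
    rw [hval, hrow']
    split_ifs at hc ⊢ <;> omega
  · rw [hval, hrow']
    split_ifs <;> omega
  · have hc := hcol p
    rw [hcol', hcol'] at hc
    rw [hval, hrow']
    split_ifs at hc ⊢ <;> omega
  · have hr : (T.1 (σ p)).1 = (T.1 (σ q)).1 := by
      rw [← hval, ← hval]; exact congrArg Fin.val hupq
    have hc : (T.1 (σ p)).2 = (T.1 (σ q)).2 := by rw [hcol, hcol, hpq]
    exact σ.injective (T.injective (Prod.ext hr hc))

set_option maxHeartbeats 400000 in
/-- **Twin words evaluate to `1`.**  If `u` vanishes on the arm, has letters `< 3` on column `0` and `< 2` on the first pair columns,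
is injective there, column `1` repeats column `0` (`u(p+3) = u(p)`, `p < 3`) and every second pair column repeats the first
(`u(p+2) = u(p)`), then `e_T(u) = 1`. [folklore] -/
theorem tallPairTableau_twin_eq_one {N k : ℕ} {Y : YoungDiagram} (hN : ∀ x ∈ Y.cells, x.1 < N)
    (T : StdFilling (N * 2) Y)
    (hT : ∀ p : Fin (N * 2), T.1 p = (if (p : ℕ) < 6 then ((p : ℕ) % 3, (p : ℕ) / 3)
      else if (p : ℕ) < 4 * k + 6 then ((p : ℕ) % 2, (p : ℕ) / 2 - 1) else (0, (p : ℕ) - 2 * k - 4)))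
    (hk : 4 * k + 6 ≤ N * 2) {u : Word N (N * 2)}
    (harm : ∀ p : Fin (N * 2), 4 * k + 6 ≤ (p : ℕ) → ((u p : Fin N) : ℕ) = 0)
    (hlt3 : ∀ p : Fin (N * 2), (p : ℕ) < 3 → ((u p : Fin N) : ℕ) < 3)
    (hlt2 : ∀ p : Fin (N * 2), 6 ≤ (p : ℕ) → (p : ℕ) < 4 * k + 6 → ((p : ℕ) + 2) % 4 < 2 → ((u p : Fin N) : ℕ) < 2)
    (hinj3 : ∀ p q : Fin (N * 2), (p : ℕ) < 3 → (q : ℕ) < 3 → u p = u q → p = q)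
    (hinj2 : ∀ p q : Fin (N * 2), 6 ≤ (p : ℕ) → (p : ℕ) < 4 * k + 6 → 6 ≤ (q : ℕ) → (q : ℕ) < 4 * k + 6 →
      ((p : ℕ) + 2) % 4 < 2 → ((q : ℕ) + 2) % 4 < 2 → (p : ℕ) - ((p : ℕ) + 2) % 4 = (q : ℕ) - ((q : ℕ) + 2) % 4 →
      u p = u q → p = q)
    (htwin3 : ∀ (p : Fin (N * 2)) (hp : (p : ℕ) < 3), u ⟨p + 3, by omega⟩ = u p)
    (htwin2 : ∀ (p : Fin (N * 2)) (h6 : 6 ≤ (p : ℕ)) (hp : (p : ℕ) < 4 * k + 6) (hr : ((p : ℕ) + 2) % 4 < 2),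
      u ⟨p + 2, by omega⟩ = u p) :
    T.polytabloid ℂ hN u = 1 := by
  classical
  have hrow' : ∀ q : Fin (N * 2), (T.1 q).1 =
      if (q : ℕ) < 6 then (q : ℕ) % 3 else if (q : ℕ) < 4 * k + 6 then (q : ℕ) % 2 else 0 := fun q => by
    rw [hT]; split_ifs <;> rfl
  have hcol' : ∀ q : Fin (N * 2), (T.1 q).2 =
      if (q : ℕ) < 6 then (q : ℕ) / 3 else if (q : ℕ) < 4 * k + 6 then (q : ℕ) / 2 - 1 else (q : ℕ) - 2 * k - 4 :=
    fun q => by rw [hT]; split_ifs <;> rfl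
  -- `ρ₀`: the permutation of the first columns realising `u` there
  let S := {p : Fin (N * 2) // (p : ℕ) < 3 ∨ (6 ≤ (p : ℕ) ∧ (p : ℕ) < 4 * k + 6 ∧ ((p : ℕ) + 2) % 4 < 2)}
  have hult : ∀ x : S, ((u x.1 : Fin N) : ℕ) < 3 ∧ (6 ≤ ((x.1 : Fin (N * 2)) : ℕ) → ((u x.1 : Fin N) : ℕ) < 2) := by
    intro x
    rcases x.2 with h | ⟨h1, h2, h3⟩
    · exact ⟨hlt3 x.1 h, fun h' => by omega⟩
    · have := hlt2 x.1 h1 h2 h3; exact ⟨by omega, fun _ => this⟩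
  have hb : ∀ x : S, ((x.1 : Fin (N * 2)) : ℕ) - (((x.1 : Fin (N * 2)) : ℕ) + 2) % 4 - 2 * ((5 - ((x.1 : Fin (N * 2)) : ℕ)) / 3) + ((u x.1 : Fin N) : ℕ) < N * 2 := by
    intro x; have := hult x; have := x.2; omega
  let f₀ : S → S := fun x =>
    ⟨⟨((x.1 : Fin (N * 2)) : ℕ) - (((x.1 : Fin (N * 2)) : ℕ) + 2) % 4 - 2 * ((5 - ((x.1 : Fin (N * 2)) : ℕ)) / 3) + ((u x.1 : Fin N) : ℕ), hb x⟩,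
      by have := hult x; have := x.2; simp only; omega⟩
  have hf₀v : ∀ x : S, (((f₀ x).1 : Fin (N * 2)) : ℕ) =
      ((x.1 : Fin (N * 2)) : ℕ) - (((x.1 : Fin (N * 2)) : ℕ) + 2) % 4 - 2 * ((5 - ((x.1 : Fin (N * 2)) : ℕ)) / 3) + ((u x.1 : Fin N) : ℕ) := fun x => rfl
  have hf₀ : Function.Injective f₀ := by
    rintro ⟨p, hp⟩ ⟨q, hq⟩ hpq
    have h1 := congrArg (fun x : S => ((x.1 : Fin (N * 2)) : ℕ)) hpq
    simp only [hf₀v] at h1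
    apply Subtype.ext
    have hup := hult ⟨p, hp⟩
    have huq := hult ⟨q, hq⟩
    simp only at hup huq
    rcases hp with hp | ⟨hp1, hp2, hp3⟩ <;> rcases hq with hq | ⟨hq1, hq2, hq3⟩
    · exact hinj3 p q hp hq (Fin.ext (by omega))
    · exfalso; have := huq.2 hq1; omega
    · exfalso; have := hup.2 hp1; omega
    · have := hup.2 hp1; have := huq.2 hq1
      exact hinj2 p q hp1 hp2 hq1 hq2 hp3 hq3 (by omega) (Fin.ext (by omega))
  let F₀ : Equiv.Perm S := Equiv.ofBijective f₀ (Finite.injective_iff_bijective.1 hf₀)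
  let ρ₀ : Equiv.Perm (Fin (N * 2)) := Equiv.Perm.ofSubtype F₀
  have hρ₀S : ∀ (p : Fin (N * 2)) (hp : (p : ℕ) < 3 ∨ (6 ≤ (p : ℕ) ∧ (p : ℕ) < 4 * k + 6 ∧ ((p : ℕ) + 2) % 4 < 2)),
      ((ρ₀ p : Fin (N * 2)) : ℕ) = (p : ℕ) - ((p : ℕ) + 2) % 4 - 2 * ((5 - (p : ℕ)) / 3) + ((u p : Fin N) : ℕ) := by
    intro p hp
    show ((Equiv.Perm.ofSubtype F₀ p : Fin (N * 2)) : ℕ) = _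
    rw [Equiv.Perm.ofSubtype_apply_of_mem F₀ hp]
    exact hf₀v ⟨p, hp⟩
  have hρ₀_fix : ∀ p : Fin (N * 2), ¬ ((p : ℕ) < 3 ∨ (6 ≤ (p : ℕ) ∧ (p : ℕ) < 4 * k + 6 ∧ ((p : ℕ) + 2) % 4 < 2)) →
      ρ₀ p = p := fun p hp =>
    Equiv.Perm.ofSubtype_apply_of_not_mem F₀ hp
  -- `κ`: the row-wise exchange of the two columns of each pair (tall pair included)
  let kf : Fin (N * 2) → Fin (N * 2) := fun p =>
    if h3 : (p : ℕ) < 3 then ⟨p + 3, by omega⟩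
    else if h6 : (p : ℕ) < 6 then ⟨p - 3, by omega⟩
    else if hp : (p : ℕ) < 4 * k + 6 then
      (if hp' : ((p : ℕ) + 2) % 4 < 2 then ⟨p + 2, by omega⟩ else ⟨p - 2, by omega⟩)
    else p
  have hkf : ∀ p, ((kf p : Fin (N * 2)) : ℕ) =
      if (p : ℕ) < 3 then (p : ℕ) + 3 else if (p : ℕ) < 6 then (p : ℕ) - 3
      else if (p : ℕ) < 4 * k + 6 then (if ((p : ℕ) + 2) % 4 < 2 then (p : ℕ) + 2 else (p : ℕ) - 2) else p := by
    intro p; simp only [kf]; split_ifs <;> rfl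
  have hkι : Function.Involutive kf := by
    intro p
    apply Fin.ext
    rw [hkf, hkf]
    split_ifs <;> omega
  let κ : Equiv.Perm (Fin (N * 2)) := Function.Involutive.toPerm kf hkι
  have hκ : ∀ p, ((κ p : Fin (N * 2)) : ℕ) =
      if (p : ℕ) < 3 then (p : ℕ) + 3 else if (p : ℕ) < 6 then (p : ℕ) - 3
      else if (p : ℕ) < 4 * k + 6 then (if ((p : ℕ) + 2) % 4 < 2 then (p : ℕ) + 2 else (p : ℕ) - 2) else p := hkf
  let ρ : Equiv.Perm (Fin (N * 2)) := ρ₀ * (κ * ρ₀ * κ)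
  have hρ : ∀ p, ρ p = ρ₀ (κ (ρ₀ (κ p))) := fun p => rfl
  -- values of `ρ`
  have hρ_fc : ∀ p : Fin (N * 2), ((p : ℕ) < 3 ∨ (6 ≤ (p : ℕ) ∧ (p : ℕ) < 4 * k + 6 ∧ ((p : ℕ) + 2) % 4 < 2)) →
      ((ρ p : Fin (N * 2)) : ℕ) = (p : ℕ) - ((p : ℕ) + 2) % 4 - 2 * ((5 - (p : ℕ)) / 3) + ((u p : Fin N) : ℕ) := by
    intro p hp
    have h1 : ((κ p : Fin (N * 2)) : ℕ) = if (p : ℕ) < 3 then (p : ℕ) + 3 else (p : ℕ) + 2 := by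
      rw [hκ]; split_ifs <;> omega
    have h2 : ρ₀ (κ p) = κ p := hρ₀_fix _ (by rw [h1]; split_ifs <;> omega)
    have h3 : κ (κ p) = p := hkι p
    rw [hρ, h2, h3]
    exact hρ₀S p hp
  have hρ_tall : ∀ (p : Fin (N * 2)) (hp : 3 ≤ (p : ℕ)) (hp' : (p : ℕ) < 6),
      ((ρ p : Fin (N * 2)) : ℕ) = ((u ⟨p - 3, by omega⟩ : Fin N) : ℕ) + 3 := by
    intro p hp hp'
    have h1 : ((κ p : Fin (N * 2)) : ℕ) = p - 3 := by rw [hκ, if_neg (by omega), if_pos hp']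
    have h1' : κ p = ⟨p - 3, by omega⟩ := Fin.ext h1
    have hu' : ((u ⟨p - 3, by omega⟩ : Fin N) : ℕ) < 3 := hlt3 _ (by simp; omega)
    have h2 : ((ρ₀ (κ p) : Fin (N * 2)) : ℕ) = ((u ⟨p - 3, by omega⟩ : Fin N) : ℕ) := by
      rw [h1', hρ₀S _ (Or.inl (by simp; omega))]
      simp only
      omega
    have h3 : ((κ (ρ₀ (κ p)) : Fin (N * 2)) : ℕ) = ((u ⟨p - 3, by omega⟩ : Fin N) : ℕ) + 3 := by
      rw [hκ, h2, if_pos hu']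
    have h4 : ρ₀ (κ (ρ₀ (κ p))) = κ (ρ₀ (κ p)) := hρ₀_fix _ (by rw [h3]; omega)
    rw [hρ, h4, h3]
  have hρ_pair : ∀ (p : Fin (N * 2)) (hp : 6 ≤ (p : ℕ)) (hp' : (p : ℕ) < 4 * k + 6)
      (hr : ¬ ((p : ℕ) + 2) % 4 < 2),
      ((ρ p : Fin (N * 2)) : ℕ) = (p : ℕ) - (p : ℕ) % 4 + ((u ⟨p - 2, by omega⟩ : Fin N) : ℕ) := by
    intro p hp hp' hr
    have hp8 : 8 ≤ (p : ℕ) := by omega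
    have h1 : ((κ p : Fin (N * 2)) : ℕ) = p - 2 := by
      rw [hκ, if_neg (by omega), if_neg (by omega), if_pos hp', if_neg hr]
    have h1' : κ p = ⟨p - 2, by omega⟩ := Fin.ext h1
    have hu' : ((u ⟨p - 2, by omega⟩ : Fin N) : ℕ) < 2 :=
      hlt2 _ (by simp; omega) (by simp; omega) (by simp; omega)
    have h2 : ((ρ₀ (κ p) : Fin (N * 2)) : ℕ) = (p : ℕ) - 2 - (p : ℕ) % 4 + ((u ⟨p - 2, by omega⟩ : Fin N) : ℕ) := by
      rw [h1', hρ₀S _ (Or.inr ⟨by simp; omega, by simp; omega, by simp; omega⟩)]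
      simp only
      omega
    have h3 : ((κ (ρ₀ (κ p)) : Fin (N * 2)) : ℕ) = (p : ℕ) - (p : ℕ) % 4 + ((u ⟨p - 2, by omega⟩ : Fin N) : ℕ) := by
      rw [hκ, h2, if_neg (by omega), if_neg (by omega), if_pos (by omega), if_pos (by omega)]
      omega
    have h4 : ρ₀ (κ (ρ₀ (κ p))) = κ (ρ₀ (κ p)) := hρ₀_fix _ (by rw [h3]; omega)
    rw [hρ, h4, h3]
  have hρ_ge : ∀ p : Fin (N * 2), 4 * k + 6 ≤ (p : ℕ) → ρ p = p := by
    intro p hp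
    have h1 : κ p = p := Fin.ext (by rw [hκ]; split_ifs <;> omega)
    have h2 : ρ₀ p = p := hρ₀_fix _ (by omega)
    rw [hρ, h1, h2, h1, h2]
  -- `ρ` is a column permutation and `u = w_T ∘ ρ`
  have hρC : ρ ∈ T.colStab := by
    rw [StdFilling.mem_colStab]
    intro p
    rw [hcol', hcol']
    by_cases h3 : (p : ℕ) < 3
    · have e1 := hρ_fc p (Or.inl h3)
      have := hlt3 p h3
      rw [if_pos (by omega), if_pos (by omega), e1]
      omega
    by_cases h6 : (p : ℕ) < 6
    · have e1 := hρ_tall p (by omega) h6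
      have := hlt3 ⟨p - 3, by omega⟩ (by simp; omega)
      rw [if_pos (by omega), if_pos h6, e1]
      omega
    by_cases h0 : (p : ℕ) < 4 * k + 6
    · by_cases h1 : ((p : ℕ) + 2) % 4 < 2
      · have e1 := hρ_fc p (Or.inr ⟨by omega, h0, h1⟩)
        have := hlt2 p (by omega) h0 h1
        rw [if_neg (by omega), if_pos (by omega), if_neg h6, if_pos h0, e1]
        omega
      · have e1 := hρ_pair p (by omega) h0 h1
        have := hlt2 ⟨p - 2, by omega⟩ (by simp; omega) (by simp; omega) (by simp; omega)
        rw [if_neg (by omega), if_pos (by omega), if_neg h6, if_pos h0, e1]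
        omega
    · rw [hρ_ge p (by omega)]
  have hw : u = StdFilling.rowWord hN T ∘ ⇑ρ := by
    funext p
    apply Fin.ext
    show ((u p : Fin N) : ℕ) = (T.1 (ρ p)).1
    rw [hrow']
    by_cases h3 : (p : ℕ) < 3
    · have e1 := hρ_fc p (Or.inl h3)
      have := hlt3 p h3
      rw [if_pos (by omega), e1]
      omega
    by_cases h6 : (p : ℕ) < 6
    · have e1 := hρ_tall p (by omega) h6
      have hu' := hlt3 ⟨p - 3, by omega⟩ (by simp; omega)
      rw [if_pos (by omega), e1]
      have e2 := htwin3 ⟨p - 3, by omega⟩ (by simp; omega)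
      have e3 : (⟨((⟨(p : ℕ) - 3, by omega⟩ : Fin (N * 2)) : ℕ) + 3, by simp; omega⟩ : Fin (N * 2)) = p :=
        Fin.ext (by simp; omega)
      rw [e3] at e2
      rw [e2]
      omega
    by_cases h0 : (p : ℕ) < 4 * k + 6
    · by_cases h1 : ((p : ℕ) + 2) % 4 < 2
      · have e1 := hρ_fc p (Or.inr ⟨by omega, h0, h1⟩)
        have := hlt2 p (by omega) h0 h1
        rw [if_neg (by omega), if_pos (by omega), e1]
        omega
      · have e1 := hρ_pair p (by omega) h0 h1
        have hu' := hlt2 ⟨p - 2, by omega⟩ (by simp; omega) (by simp; omega) (by simp; omega)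
        rw [if_neg (by omega), if_pos (by omega), e1]
        have e2 := htwin2 ⟨p - 2, by omega⟩ (by simp; omega) (by simp; omega) (by simp; omega)
        have e3 : (⟨((⟨(p : ℕ) - 2, by omega⟩ : Fin (N * 2)) : ℕ) + 2, by simp; omega⟩ : Fin (N * 2)) = p :=
          Fin.ext (by simp; omega)
        rw [e3] at e2
        rw [e2]
        omega
    · rw [hρ_ge p (by omega), if_neg (by omega), if_neg h0]
      exact harm p (by omega)
  have key := congrFun (StdFilling.wordPerm_polytabloid_of_mem_colStab (k := ℂ) hN T hρC)
    (StdFilling.rowWord hN T)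
  rw [wordPerm_apply, ← hw, Pi.smul_apply, StdFilling.polytabloid_apply_rowWord, smul_eq_mul,
    mul_one] at key
  rw [key]
  have hs : Equiv.Perm.sign ρ = 1 := by
    show Equiv.Perm.sign (ρ₀ * (κ * ρ₀ * κ)) = 1
    simp only [Equiv.Perm.sign_mul]
    rcases Int.units_eq_one_or (Equiv.Perm.sign ρ₀) with h1 | h1 <;>
    rcases Int.units_eq_one_or (Equiv.Perm.sign κ) with h2 | h2 <;> simp [h1, h2]
  rw [hs]
  simp

end Summit.MatrixMultiplication.MatrixMultiplication.Theorems.ObstructionCalculus
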